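import Summits.CriticalPhenomena.SAWScalingLimit.Theses.SAWMassiveIsingTilt
import Summits.CriticalPhenomena.SAWScalingLimit.Theorems.SAWMassiveIsingTiltHexEndpointApproxExists
import Summits.CriticalPhenomena.SAWScalingLimit.Theorems.SAWDefectDecoherenceObservableToSLERTwoPieceAdmIdentificationMesh
import Literature.Probability.RandomPlanarGeometry.ConformalRestrictionProofs
import Literature.Probability.Percolation.TriLoopWinding
import HarnessLib

/-!
# Crux `MassiveWindowSLE` (stmt-CriticalPhenomena-7685), line `registered` (skeleton r7):
stub `stub_windowDiscrepancyGeometry` — discrepancy edges of `Ω_δ ⊇ Ω'_δ` lie near the removed hull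

Route `SAWMassiveIsingTilt` of `CriticalPhenomena/SAWScalingLimit`; lead prover c3 of the line
`registered` (skeleton r7). Stub Mgeo (tag `wdg`, lattice geometry): the geometry the ratio-mixing
engine (stub Mmix) needs about the honeycomb discretisations `Ω_δ ⊇ Ω'_δ` of a hull pair of
Dobrushin domains `D ⊇ D'` (`MarkedDomain.IsHullSubdomain`).

What. (0) A Euclidean ball of radius `ρ ≥ 0` contains finitely many, at most `C₀ (ρ + 1)²`
(`C₀ = 200`), honeycomb vertices. Eventually as `δ → 0⁺`: (1) `Ω'_δ ⊆ Ω_δ` (`SAW.embMeshDomain`);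
(2) `hexDomainGraph D' δ ≤ hexDomainGraph D δ`; (3) every edge `{u, w}` of `hexDomainGraph D δ` at
a vertex `u ∈ Ω'_δ` which is not an edge of `hexDomainGraph D' δ` has `δ · hexCenter u` within `δ`
of `K = closure (D ∖ D')`.

Proof. (0) `Re c(x,t) = x₀ + x₁/2 + (t+1)/2`, `Im c(x,t) = (x₁ + (t+1)/3) √3/2`
(`Percolation.hexCenter_re/_im`), so `dist (c w) z ≤ ρ` puts both cell coordinates in integer
windows of half-width `⌈2ρ + 3⌉`; inject `w ↦ (x₀, x₁, t)` (`2 (2N+1)² ≤ 200 (ρ+1)²`). (1) Fix a closed disc `B ⊆ D' ⊆ D`; by "the largest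
honeycomb mesh component of a Jordan domain is the bulk"
(`HexEndpointApprox.exists_forall_mem_hexMeshDomain_and_reachable`, for `D'` and for `D`), for
small `δ` a honeycomb vertex `u₀` with mesh point in `B` lies in both discrete domains and `Ω'_δ` is
one mesh component of `D'`; a mesh path of `D'` from `u₀` to `v ∈ Ω'_δ` is a mesh path of `D`
(monotonicity) from `u₀ ∈ Ω_δ`, hence an `Ω_δ`-path, so `v ∈ Ω_δ`. (2) follows. (3) If the rescaled
segment lay in `cl D'` AND `δ c w ∈ D'`, `{u, w}` would be a mesh edge of `D'` at the vertex `u` of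
the union of components `Ω'_δ`, forcing `w ∈ Ω'_δ` (`HexEndpointApprox.mem_embMeshDomain_of_adj`)
and an `Ω'_δ`-edge — excluded. So either `δ c w ∈ D ∖ D' ⊆ K`, or a point of the segment lies in
`cl D ∖ cl D' ⊆ cl (D ∖ D')`; both witnesses lie on `[δ c u, δ c w] ⊆ B̄(δ c u, δ)` (adjacent
rescaled centres are at distance `δ/√3 ≤ δ`: `ObservableToSLER.TwoPiece.dist_smul_hexCenter_le_of_adj`).

Credits: `wdg_…_mono`, `wdg_reachable_embDomainGraph_of_mem` adapted from the private `cea_…`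
lemmas of `…MassiveWindowSLEStubCommonEndpointApprox.lean`; the counting template from
`ScreeningRecursion.ncard_lattice_closedBall_le`. References: H. Duminil-Copin, S. Smirnov, Ann. of
Math. 175 (2012), §4 (discrete domains `Ω_δ`); G. F. Lawler, O. Schramm, W. Werner, J. Amer. Math.
Soc. 16 (2003), §1 (restriction to `D ∖ A`); G. Grimmett, *Percolation* (1999), §1.6.
-/

noncomputable section

namespace Summit.CriticalPhenomena.SAWScalingLimit.Theorems.MassiveWindowSLE.Birth

open scoped BigOperators Topology Classical MeasureTheory NNReal ENNReal
open Filter Set MeasureTheory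
open Literature.Probability Literature.Probability.LatticeModels Literature.Probability.RandomPlanarGeometry
open Literature.Probability.RandomPlanarGeometry.SAW Metric

/-! ### Counting honeycomb vertices in Euclidean balls -/

/-- **Coordinate windows.** A face centre within `ρ` of `z` has both cell coordinates within
`2ρ + 2` of the real numbers `α₀ = Re z − Im z/√3`, `α₁ = 2 Im z/√3`. [folklore] -/
theorem wdg_coord_bounds {z : ℂ} {ρ : ℝ} {w : HexVertex} (hw : dist (hexCenter w) z ≤ ρ) :
    |((w.1 0 : ℤ) : ℝ) - (z.re - z.im / Real.sqrt 3)| ≤ 2 * ρ + 2 ∧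
      |((w.1 1 : ℤ) : ℝ) - 2 * z.im / Real.sqrt 3| ≤ 2 * ρ + 2 := by
  obtain ⟨x, t⟩ := w
  set s : ℝ := Real.sqrt 3 with hs_def
  have hs3 : s * s = 3 := Real.mul_self_sqrt (by norm_num)
  have hs0 : 0 < s := Real.sqrt_pos.2 (by norm_num)
  have hs_ne : s ≠ 0 := hs0.ne'
  have hs1 : 1 ≤ s := by nlinarith
  have hs2 : s ≤ 2 := by nlinarith
  have hρ0 : 0 ≤ ρ := dist_nonneg.trans hw
  have ht1 : ((t : ℕ) : ℝ) ≤ 1 := by exact_mod_cast Nat.lt_succ_iff.1 t.isLt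
  have ht0 : (0 : ℝ) ≤ ((t : ℕ) : ℝ) := Nat.cast_nonneg _
  rw [dist_eq_norm] at hw
  have hre : |(x 0 : ℝ) + (x 1 : ℝ) / 2 + ((t : ℕ) + 1) / 2 - z.re| ≤ ρ := by
    have h := Complex.abs_re_le_norm (hexCenter (x, t) - z)
    rw [Complex.sub_re, Literature.Probability.Percolation.hexCenter_re] at h
    exact h.trans hw
  have him : |((x 1 : ℝ) + ((t : ℕ) + 1) / 3) * (s / 2) - z.im| ≤ ρ := by
    have h := Complex.abs_im_le_norm (hexCenter (x, t) - z)
    rw [Complex.sub_im, Literature.Probability.Percolation.hexCenter_im] at h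
    exact h.trans hw
  rw [abs_le] at hre him
  obtain ⟨hre1, hre2⟩ := hre
  obtain ⟨him1, him2⟩ := him
  -- the second coordinate: `s · e₁ = 2 (Im c − Im z) − (t + 1) s / 3`
  set e₁ : ℝ := (x 1 : ℝ) - 2 * z.im / s with he₁
  have hmul : s * (2 * z.im / s) = 2 * z.im := by field_simp
  have hkey₁ : s * e₁ =
      2 * (((x 1 : ℝ) + ((t : ℕ) + 1) / 3) * (s / 2) - z.im) - ((t : ℕ) + 1) * s / 3 := by
    rw [he₁, mul_sub, hmul]; ring
  have hse₁_le : s * e₁ ≤ 2 * ρ := by nlinarith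
  have hse₁_ge : -(2 * ρ) - 2 * s / 3 ≤ s * e₁ := by nlinarith
  have he₁_le : e₁ ≤ 2 * ρ + 2 := by
    rcases le_or_gt e₁ 0 with he | he
    · linarith
    · nlinarith
  have he₁_ge : -(2 * ρ + 2) ≤ e₁ := by
    rcases le_or_gt 0 e₁ with he | he
    · linarith
    · nlinarith
  -- the first coordinate: `e₀ = (Re c − Re z) − (t + 1)/2 − e₁/2`
  have hdiv : z.im / s = ((x 1 : ℝ) - e₁) / 2 := by rw [he₁]; ring
  have hkey₀ : (x 0 : ℝ) - (z.re - z.im / s) =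
      ((x 0 : ℝ) + (x 1 : ℝ) / 2 + ((t : ℕ) + 1) / 2 - z.re) - ((t : ℕ) + 1) / 2 - e₁ / 2 := by
    rw [hdiv]; ring
  refine ⟨?_, abs_le.2 ⟨he₁_ge, he₁_le⟩⟩
  rw [hkey₀, abs_le]
  constructor <;> linarith

/-- Integers within `2ρ + 2` of a real number `α` lie in the window `[⌊α⌋ − N, ⌊α⌋ + N]` as soon
as `2ρ + 3 ≤ N`. [folklore] -/
theorem wdg_mem_Icc_of_abs_sub_le {m : ℤ} {α ρ : ℝ} {N : ℕ} (hN : 2 * ρ + 3 ≤ N)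
    (hm : |(m : ℝ) - α| ≤ 2 * ρ + 2) : m ∈ Finset.Icc (⌊α⌋ - N) (⌊α⌋ + N) := by
  rw [abs_le] at hm
  have hfl := Int.floor_le α
  have hfl' := Int.lt_floor_add_one α
  have h1 : ((⌊α⌋ : ℤ) : ℝ) - (N : ℝ) ≤ m := by linarith
  have h2 : (m : ℝ) ≤ ((⌊α⌋ : ℤ) : ℝ) + N := by linarith
  rw [Finset.mem_Icc]
  constructor
  · exact_mod_cast h1
  · exact_mod_cast h2

/-- **Counting honeycomb vertices in balls.** The face centres within `ρ ≥ 0` of a point form a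
finite set of cardinality at most `200 (ρ + 1)²` (injection `w ↦ (x₀, x₁, t)` into a product of
two integer windows of width `2⌈2ρ+3⌉ + 1 ≤ 4ρ + 9` and `Fin 2`). [folklore] -/
theorem wdg_ball_count (z : ℂ) {ρ : ℝ} (hρ : 0 ≤ ρ) :
    {w : HexVertex | dist (hexCenter w) z ≤ ρ}.Finite ∧
      ({w : HexVertex | dist (hexCenter w) z ≤ ρ}.ncard : ℝ) ≤ 200 * (ρ + 1) ^ 2 := by
  classical
  -- adapted from `ScreeningRecursion.ncard_lattice_closedBall_le`
  set S : Set HexVertex := {w | dist (hexCenter w) z ≤ ρ} with hS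
  set α₀ : ℝ := z.re - z.im / Real.sqrt 3 with hα₀
  set α₁ : ℝ := 2 * z.im / Real.sqrt 3 with hα₁
  set N : ℕ := ⌈2 * ρ + 3⌉₊ with hN
  have hNle : (N : ℝ) ≤ 2 * ρ + 4 := by
    have := Nat.ceil_lt_add_one (show 0 ≤ 2 * ρ + 3 by positivity)
    rw [hN]; linarith
  have hNge : 2 * ρ + 3 ≤ N := Nat.le_ceil _
  set f : HexVertex → (ℤ × ℤ) × Fin 2 := fun w => ((w.1 0, w.1 1), w.2) with hf
  have hfi : Function.Injective f := by
    rintro ⟨x, t⟩ ⟨x', t'⟩ h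
    simp only [hf, Prod.mk.injEq] at h
    obtain ⟨⟨h0, h1⟩, h2⟩ := h
    refine Prod.ext ?_ h2
    funext l; fin_cases l
    · exact h0
    · exact h1
  set T : Finset ((ℤ × ℤ) × Fin 2) :=
    ((Finset.Icc (⌊α₀⌋ - N) (⌊α₀⌋ + N)) ×ˢ (Finset.Icc (⌊α₁⌋ - N) (⌊α₁⌋ + N))) ×ˢ Finset.univ
    with hT
  have hST : ∀ w ∈ S, f w ∈ T := by
    intro w hw
    obtain ⟨h0, h1⟩ := wdg_coord_bounds (show dist (hexCenter w) z ≤ ρ from hw)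
    simp only [hT, hf, Finset.mem_product, Finset.mem_univ, and_true]
    exact ⟨wdg_mem_Icc_of_abs_sub_le hNge h0, wdg_mem_Icc_of_abs_sub_le hNge h1⟩
  have hfin : S.Finite :=
    ((Finset.finite_toSet T).preimage hfi.injOn).subset fun w hw => Finset.mem_coe.2 (hST w hw)
  refine ⟨hfin, ?_⟩
  have hle : S.ncard ≤ T.card := by
    rw [← Set.ncard_image_of_injective S hfi, ← Set.ncard_coe_finset]
    refine Set.ncard_le_ncard ?_ (Finset.finite_toSet _)
    rintro _ ⟨w, hw, rfl⟩
    exact Finset.mem_coe.2 (hST w hw)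
  have hTcard : (T.card : ℝ) = 2 * (2 * N + 1) ^ 2 := by
    rw [hT, Finset.card_product, Finset.card_product, Int.card_Icc, Int.card_Icc, Finset.card_univ,
      Fintype.card_fin]
    have e : ∀ a : ℤ, (a + N + 1 - (a - N)).toNat = 2 * N + 1 := fun a => by omega
    rw [e, e]
    push_cast
    ring
  calc (S.ncard : ℝ) ≤ T.card := by exact_mod_cast hle
    _ = 2 * (2 * N + 1) ^ 2 := hTcard
    _ ≤ 2 * (4 * ρ + 9) ^ 2 := by
        have h1 : 2 * (N : ℝ) + 1 ≤ 4 * ρ + 9 := by linarith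
        have h0 : 0 ≤ 2 * (N : ℝ) + 1 := by positivity
        nlinarith
    _ ≤ 200 * (ρ + 1) ^ 2 := by nlinarith

/-! ### Monotonicity of the mesh graph in the domain -/

/-- Mesh vertices are monotone in the domain: `Ω' ⊆ Ω` gives
`embMeshVertices emb Ω' δ ⊆ embMeshVertices emb Ω δ`. [folklore] -/
theorem wdg_mem_embMeshVertices_mono {V : Type*} (emb : V → ℂ) {Ω Ω' : Set ℂ}
    (h : Ω' ⊆ Ω) {δ : ℝ} {v : V} (hv : v ∈ embMeshVertices emb Ω' δ) :
    v ∈ embMeshVertices emb Ω δ :=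
  -- adapted from `cea_mem_embMeshVertices_mono` (…StubCommonEndpointApprox.lean)
  h (show (δ : ℂ) * emb v ∈ Ω' from hv)

/-- Mesh edges are monotone in the domain: a `G`-edge whose rescaled segment lies in `closure Ω'`
has it in `closure Ω ⊇ closure Ω'`. [folklore] -/
theorem wdg_embMeshGraph_adj_mono {V : Type*} (G : SimpleGraph V) (emb : V → ℂ)
    {Ω Ω' : Set ℂ} (h : Ω' ⊆ Ω) {δ : ℝ} {v w : V} (hvw : (embMeshGraph G emb Ω' δ).Adj v w) :
    (embMeshGraph G emb Ω δ).Adj v w := by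
  -- adapted from `cea_embMeshGraph_adj_mono` (…StubCommonEndpointApprox.lean)
  rw [embMeshGraph_adj_iff] at hvw ⊢
  exact ⟨hvw.1, hvw.2.trans (closure_mono h)⟩

/-- Reachability in the mesh graph on mesh vertices is monotone in the domain: a mesh path of
`Ω'` is a mesh path of `Ω ⊇ Ω'` (inclusion of induced subgraphs, by induction on the walk).
[folklore] -/
theorem wdg_reachable_embMeshVertexGraph_mono {V : Type*} {G : SimpleGraph V}
    {emb : V → ℂ} {Ω Ω' : Set ℂ} (h : Ω' ⊆ Ω) {δ : ℝ} {x y : embMeshVertices emb Ω' δ}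
    (hxy : (embMeshVertexGraph G emb Ω' δ).Reachable x y) :
    (embMeshVertexGraph G emb Ω δ).Reachable ⟨x.1, wdg_mem_embMeshVertices_mono emb h x.2⟩
      ⟨y.1, wdg_mem_embMeshVertices_mono emb h y.2⟩ := by
  -- adapted from `cea_reachable_embMeshVertexGraph_mono` (…StubCommonEndpointApprox.lean)
  obtain ⟨p⟩ := hxy
  induction p with
  | nil => rfl
  | @cons u v w hadj _ ih =>
    have hadj' : (embMeshGraph G emb Ω δ).Adj u v :=
      wdg_embMeshGraph_adj_mono G emb h
        (by simpa only [SimpleGraph.comap_adj, Function.Embedding.subtype_apply] using hadj)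
    have hadj'' : (embMeshVertexGraph G emb Ω δ).Adj
        ⟨u.1, wdg_mem_embMeshVertices_mono emb h u.2⟩
        ⟨v.1, wdg_mem_embMeshVertices_mono emb h v.2⟩ := by
      simpa only [SimpleGraph.comap_adj, Function.Embedding.subtype_apply] using hadj'
    exact hadj''.reachable.trans ih

/-- Distinct vertices joined in `Ω_δ` lie in `Ω_δ` (the first edge of a joining walk carries
membership of its ends in `embMeshDomain`). [folklore] -/
theorem wdg_mem_embMeshDomain_of_reachable_ne {V : Type*} {G : SimpleGraph V}
    {emb : V → ℂ} {Ω : Set ℂ} {δ : ℝ} {x y : V} (h : (embDomainGraph G emb Ω δ).Reachable x y)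
    (hne : x ≠ y) : x ∈ embMeshDomain G emb Ω δ := by
  -- adapted from `cea_mem_embMeshDomain_of_reachable_ne` (…StubCommonEndpointApprox.lean)
  obtain ⟨p⟩ := h
  cases p with
  | nil => exact absurd rfl hne
  | cons hadj _ => exact ((embDomainGraph_adj_iff G emb).1 hadj).2.1

/-- **Re-routing through the bulk.** Let `Ω' ⊆ Ω`, and suppose the discrete domain `Ω'_δ` is a
single mesh component of `Ω'`. If `u` is a vertex of both `Ω_δ` and `Ω'_δ` and `v` is a vertex of
`Ω'_δ`, then `u` and `v` are joined in `Ω_δ`: a mesh path of `Ω'` from `u` to `v` is a mesh path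
of `Ω` starting in `Ω_δ`, hence an `Ω_δ`-path (`HexEndpointApprox.reachable_embDomainGraph_of_walk`).
[folklore] -/
theorem wdg_reachable_embDomainGraph_of_mem {Ω Ω' : Set ℂ} (hΩ : Ω' ⊆ Ω) {δ : ℝ}
    {u v : HexVertex}
    (hconn : ∀ x ∈ embMeshDomain hexGraph hexCenter Ω' δ,
      ∀ y ∈ embMeshDomain hexGraph hexCenter Ω' δ,
        ∃ (hx : x ∈ embMeshVertices hexCenter Ω' δ) (hy : y ∈ embMeshVertices hexCenter Ω' δ),
          (embMeshVertexGraph hexGraph hexCenter Ω' δ).Reachable ⟨x, hx⟩ ⟨y, hy⟩)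
    (hu : u ∈ embMeshDomain hexGraph hexCenter Ω δ)
    (hu' : u ∈ embMeshDomain hexGraph hexCenter Ω' δ)
    (hv' : v ∈ embMeshDomain hexGraph hexCenter Ω' δ) :
    (embDomainGraph hexGraph hexCenter Ω δ).Reachable u v := by
  -- adapted from `cea_reachable_embDomainGraph_of_mem` (…StubCommonEndpointApprox.lean)
  obtain ⟨_, _, hr⟩ := hconn u hu' v hv'
  obtain ⟨q⟩ := wdg_reachable_embMeshVertexGraph_mono (G := hexGraph) hΩ hr
  exact HexEndpointApprox.reachable_embDomainGraph_of_walk q hu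

/-! ### The eventual geometry of a hull pair -/

/-- **Discrepancy geometry of a hull pair, eventually.** For a hull pair `D' ⊆ D`, for all small
`δ > 0`: (1) `Ω'_δ ⊆ Ω_δ`; (2) `hexDomainGraph D' δ ≤ hexDomainGraph D δ`; (3) every edge of
`hexDomainGraph D δ` at a vertex of `Ω'_δ` that is not an edge of `hexDomainGraph D' δ` has its
`Ω'_δ`-end within `δ` of `closure (D ∖ D')`. See the module docstring for the proof. [folklore] -/
theorem wdg_eventually_geometry {D D' : DobrushinDomain} (hDD' : D.IsHullSubdomain D') :
    ∀ᶠ δ in 𝓝[>] (0 : ℝ),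
      embMeshDomain hexGraph hexCenter D'.carrier δ ⊆ embMeshDomain hexGraph hexCenter D.carrier δ ∧
      hexDomainGraph D'.carrier δ ≤ hexDomainGraph D.carrier δ ∧
      ∀ u w : HexVertex, (hexDomainGraph D.carrier δ).Adj u w →
        ¬ (hexDomainGraph D'.carrier δ).Adj u w →
        u ∈ embMeshDomain hexGraph hexCenter D'.carrier δ →
        ∃ k ∈ closure (D.carrier \ D'.carrier), dist ((δ : ℂ) * hexCenter u) k ≤ δ := by
  -- a closed disc `B ⊆ D' ⊆ D`
  obtain ⟨z₀, hz₀⟩ := D'.toJordanDomain.nonempty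
  obtain ⟨ε, hε, hball⟩ := Metric.isOpen_iff.1 D'.isOpen z₀ hz₀
  have hK' : closedBall z₀ (ε / 2) ⊆ D'.carrier :=
    (closedBall_subset_ball (by linarith)).trans hball
  have hK : closedBall z₀ (ε / 2) ⊆ D.carrier := hK'.trans hDD'.carrier_subset
  obtain ⟨δ₁, hδ₁, hgood'⟩ := HexEndpointApprox.exists_forall_mem_hexMeshDomain_and_reachable
    D'.toJordanDomain (isCompact_closedBall z₀ (ε / 2)) hK'
  obtain ⟨δ₂, hδ₂, hgood⟩ := HexEndpointApprox.exists_forall_mem_hexMeshDomain_and_reachable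
    D.toJordanDomain (isCompact_closedBall z₀ (ε / 2)) hK
  have hpos : 0 < min (min δ₁ δ₂) (ε / 6) := lt_min (lt_min hδ₁ hδ₂) (by positivity)
  filter_upwards [Ioo_mem_nhdsGT hpos] with δ hδ
  obtain ⟨hδ0, hδlt⟩ := hδ
  have hδ₁' : δ < δ₁ := hδlt.trans_le ((min_le_left _ _).trans (min_le_left _ _))
  have hδ₂' : δ < δ₂ := hδlt.trans_le ((min_le_left _ _).trans (min_le_right _ _))
  have hδε : δ < ε / 6 := hδlt.trans_le (min_le_right _ _)
  -- a honeycomb vertex `u₀` with mesh point in `B`: in both discrete domains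
  obtain ⟨u₀, hu₀⟩ := HexEndpointApprox.exists_hexVertex_dist_le_mul hδ0 z₀
  have hu₀K : (δ : ℂ) * hexCenter u₀ ∈ closedBall z₀ (ε / 2) :=
    mem_closedBall.2 (hu₀.trans (by linarith))
  have hu₀D' : u₀ ∈ embMeshDomain hexGraph hexCenter D'.carrier δ := (hgood' δ hδ0 hδ₁').1 u₀ hu₀K
  have hu₀D : u₀ ∈ embMeshDomain hexGraph hexCenter D.carrier δ := (hgood δ hδ0 hδ₂').1 u₀ hu₀K
  have hconn := (hgood' δ hδ0 hδ₁').2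
  -- (1) nesting of the discrete domains
  have hsub : embMeshDomain hexGraph hexCenter D'.carrier δ ⊆
      embMeshDomain hexGraph hexCenter D.carrier δ := by
    intro v hv
    rcases eq_or_ne v u₀ with rfl | hne
    · exact hu₀D
    · exact wdg_mem_embMeshDomain_of_reachable_ne
        (wdg_reachable_embDomainGraph_of_mem hDD'.carrier_subset hconn hu₀D hu₀D' hv).symm hne
  -- (2) nesting of the domain graphs
  have hle : hexDomainGraph D'.carrier δ ≤ hexDomainGraph D.carrier δ := by
    intro u w huw
    obtain ⟨hmesh, hu, hw⟩ := (embDomainGraph_adj_iff hexGraph hexCenter).1 huw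
    exact (embDomainGraph_adj_iff hexGraph hexCenter).2
      ⟨wdg_embMeshGraph_adj_mono hexGraph hexCenter hDD'.carrier_subset hmesh, hsub hu, hsub hw⟩
  refine ⟨hsub, hle, fun u w huw hnuw hu' => ?_⟩
  -- (3) discrepancy edges are near the removed hull
  obtain ⟨hmesh, -, hw⟩ := (embDomainGraph_adj_iff hexGraph hexCenter).1 huw
  obtain ⟨hG, hseg⟩ := (embMeshGraph_adj_iff hexGraph hexCenter).1 hmesh
  have hdist : dist ((δ : ℂ) * hexCenter u) ((δ : ℂ) * hexCenter w) ≤ δ :=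
    ObservableToSLER.TwoPiece.dist_smul_hexCenter_le_of_adj hδ0.le hG
  by_cases hcase : segment ℝ ((δ : ℂ) * hexCenter u) ((δ : ℂ) * hexCenter w) ⊆ closure D'.carrier ∧
      (δ : ℂ) * hexCenter w ∈ D'.carrier
  · -- then `{u, w}` would be an edge of `Ω'_δ`
    exfalso
    obtain ⟨hseg', hwD'⟩ := hcase
    have hmesh' : (embMeshGraph hexGraph hexCenter D'.carrier δ).Adj u w :=
      (embMeshGraph_adj_iff hexGraph hexCenter).2 ⟨hG, hseg'⟩
    have huV' : u ∈ embMeshVertices hexCenter D'.carrier δ :=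
      embMeshDomain_subset hexGraph hexCenter _ δ hu'
    have hwV' : w ∈ embMeshVertices hexCenter D'.carrier δ := hwD'
    have hw' : w ∈ embMeshDomain hexGraph hexCenter D'.carrier δ :=
      HexEndpointApprox.mem_embMeshDomain_of_adj (u := ⟨u, huV'⟩) (w := ⟨w, hwV'⟩) hu'
        (by simpa only [SimpleGraph.comap_adj, Function.Embedding.subtype_apply] using hmesh')
    exact hnuw ((embDomainGraph_adj_iff hexGraph hexCenter).2 ⟨hmesh', hu', hw'⟩)
  · rw [not_and_or] at hcase
    rcases hcase with hseg' | hwD'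
    · -- a point of the edge segment outside `cl D'` lies in `cl (D ∖ D')`
      obtain ⟨p, hp, hpD'⟩ := Set.not_subset.1 hseg'
      have hcl : closure D.carrier ⊆ closure D'.carrier ∪ closure (D.carrier \ D'.carrier) := by
        rw [← closure_union]
        exact closure_mono (Set.union_sdiff_cancel hDD'.carrier_subset).symm.subset
      have hpK : p ∈ closure (D.carrier \ D'.carrier) := (hcl (hseg hp)).resolve_left hpD'
      refine ⟨p, hpK, ?_⟩
      have hpball : p ∈ closedBall ((δ : ℂ) * hexCenter u) δ :=
        (convex_closedBall _ _).segment_subset (mem_closedBall_self hδ0.le)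
          (mem_closedBall.2 (by rw [dist_comm]; exact hdist)) hp
      exact mem_closedBall'.1 hpball
    · -- the far endpoint is a mesh vertex of `D` outside `D'`
      have hwD : (δ : ℂ) * hexCenter w ∈ D.carrier := embMeshDomain_subset hexGraph hexCenter _ δ hw
      exact ⟨(δ : ℂ) * hexCenter w, subset_closure ⟨hwD, hwD'⟩, hdist⟩

/-! ### The registered stub -/

/-- **Stub Mgeo of skeleton r7 (crux `MassiveWindowSLE`, line `registered`): discrepancy geometry
of the honeycomb discretisations of a hull pair.** (0) A Euclidean ball of radius `ρ ≥ 0` contains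
finitely many, and at most `C₀ (ρ + 1)²`, honeycomb vertices (`wdg_ball_count`, `C₀ = 200`); and
for a hull pair `D' ⊆ D`, eventually as `δ → 0⁺`: (1) `Ω'_δ ⊆ Ω_δ`, (2) `hexDomainGraph D' δ ≤
hexDomainGraph D δ`, (3) every edge of `hexDomainGraph D δ` at an `Ω'_δ`-vertex `u` that is not
an edge of `hexDomainGraph D' δ` has `δ · hexCenter u` within `δ` of `closure (D ∖ D')`
(`wdg_eventually_geometry`). Registered (fully qualified) form. -/
theorem stub_windowDiscrepancyGeometry :
    (∃ C₀ : ℝ, ∀ (z : ℂ) (ρ : ℝ), 0 ≤ ρ → {w : Literature.Probability.LatticeModels.HexVertex | dist (Literature.Probability.LatticeModels.hexCenter w) z ≤ ρ}.Finite ∧ (({w : Literature.Probability.LatticeModels.HexVertex | dist (Literature.Probability.LatticeModels.hexCenter w) z ≤ ρ}.ncard : ℝ) ≤ C₀ * (ρ + 1) ^ 2)) ∧ ∀ (D D' : Literature.Probability.RandomPlanarGeometry.DobrushinDomain), D.IsHullSubdomain D' → ∀ᶠ δ in nhdsWithin 0 (Set.Ioi 0), Literature.Probability.RandomPlanarGeometry.SAW.embMeshDomain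 Literature.Probability.LatticeModels.hexGraph Literature.Probability.LatticeModels.hexCenter D'.carrier δ ⊆ Literature.Probability.RandomPlanarGeometry.SAW.embMeshDomain Literature.Probability.LatticeModels.hexGraph Literature.Probability.LatticeModels.hexCenter D.carrier δ ∧ Literature.Probability.RandomPlanarGeometry.SAW.hexDomainGraph D'.carrier δ ≤ Literature.Probability.RandomPlanarGeometry.SAW.hexDomainGraph D.carrier δ ∧ ∀ u w : Literature.Probability.LatticeModels.HexVertex, (Literature.Probability.RandomPlanarGeometry.SAW.hexDomainGraph D.carrier δ).Adj u w → ¬ (Literature.Probability.RandomPlanarGeometry.SAW.hexDomainGraph D'.carrier δ).Adj u w → u ∈ Literature.Probability.RandomPlanarGeometry.SAW.embMeshDomain Literature.Probability.LatticeModels.hexGraph Literature.Probability.LatticeModels.hexCenter D'.carrier δ → ∃ k ∈ closure (D.carrier \ D'.carrier), dist ((δ : ℂ) * Literature.Probability.LatticeModels.hexCenter u) k ≤ δ := by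
  refine ⟨⟨200, fun z ρ hρ => wdg_ball_count z hρ⟩, fun D D' hDD' => ?_⟩
  exact wdg_eventually_geometry hDD'

end Summit.CriticalPhenomena.SAWScalingLimit.Theorems.MassiveWindowSLE.Birth
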